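import Summits.CriticalPhenomena.PercolationContinuityZ3.Theorems.SahiMasterFamilySectionExpansion

/-!
# Shielded families: a member inside which the coordinate `e` is irrelevant — `C_k` and the pointwise statement inherited from the `1`-section, every order

Unit `prim-master-conj` (crux anchor stmt-CriticalPhenomena-4575, helper work), gen 16; memo
`run/shared/lean/prim/prim-l12/prim-master-conj/POINTWISE.md` §17.  A second closure operation read off the section expansion (`…SectionExpansion`).

Call a family `U = (U_0,…,U_{k−1})` of events **shielded at `e`** (by the member `U_{k₀}`) if `U_{k₀}` is `e`-free and every `U_i ∩ U_{k₀}` is `e`-free — inside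
`U_{k₀}` the coordinate `e` is irrelevant to all members (the other members may depend on `e` ARBITRARILY outside `U_{k₀}`).  Then the coefficient
`W_p(U) = −E_k(σ;1_U)` (`σ = μ_p − μ_{p[e↦1]}`) VANISHES at every `p` (`sahiE_signedWeight_eq_zero_of_shield`: in the Lieb–Sahi recursion for `σ` with the
shield at the head, `σ(1_{U_{k₀}}) = 0` kills the product term and the updated families are again shielded), so the section expansion reads

  `E_k(μ_p; 1_U) = E_k(μ_p; 1_{U¹}) + Σ_{∅≠A⊊slots} W_p(U_A) · E_{k−|A|}(μ_p; 1_{(U¹)_{Aᶜ}})`      (`sahiE_ind_shield_eq`)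

with every `W_p(U_A) ≥ 0` for increasing `U`.  Consequences (`sahiE_ind_shield_nonneg`, `sahiE_ind_shield_settled`, `sahiE_ind_shield_pos`): `C_k` and settledness
("`E ≥ 0` and `E = 0 ↔ Z` at every interior parameter") pass from the sub-families of the `1`-SECTION FAMILY `U¹` to `U`, at every order.  Order-3 instance:
`U = (x₁(x_e ∨ x₂ ∨ x₄), x₃(x_e ∨ x₂ ∨ x₄), x₂ ∨ x₄)` (shield `x₂ ∨ x₄`): `E_3(μ_p;1_U) = E_3(x₁,x₃,x₂∨x₄) + W_p(U_0,U_1)·μ_p(x₂∨x₄) = (1−t)(d_{01} + (1−t)ν_0ν_1)μ_p(U_2) > 0`.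
HONEST FRAMING: closure properties; nothing is asserted about `C_k` / `MasterFamilyEqIff k` in general.  Axioms standard. [this work]
-/

noncomputable section

open scoped Classical

namespace Summit.CriticalPhenomena.PercolationContinuityZ3.Theorems

open Finset Function
open Literature.Combinatorics.Sahi2008
open Literature.Probability.Percolation.DecisionTree (ind ind_of_mem ind_of_not_mem ind_nonneg)
open WeightSum (sahiE_sub_univ)

namespace Pinning

variable {ι : Type} [Fintype ι]

/-! ### The shield kills `W_p` -/

/-- **Symmetry** for indicator families: any member may be moved to the front, `E_{m+1}(1_U) = E_{m+1}(1_{U_i}, 1_{U ∘ i.succAbove})`.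
[cite: Sahi2008, eqs. (4)–(7) (symmetry); tree `sahiE_comp_perm`] -/
theorem sahiE_ind_eq_cons_succAbove (μ : Set ι → ℝ) {m : ℕ} (U : Fin (m + 1) → Set (Set ι)) (i : Fin (m + 1)) :
    sahiE μ (m + 1) (fun j => ind (U j)) =
      sahiE μ (m + 1) (Matrix.vecCons (ind (U i)) (fun j => ind (U (i.succAbove j))) : Fin (m + 1) → Set ι → ℝ) := by
  have hF : (fun j => ind (U j)) = fun j => (Fin.cons (ind (U i)) (fun j => ind (U (i.succAbove j))) : Fin (m + 1) → Set ι → ℝ) (i.cycleRange j) := by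
    funext j
    rw [Fin.cons_apply_cycleRange]
    exact (congrFun (Fin.insertNth_self_removeNth i (fun j => ind (U j))) j).symm
  conv_lhs => rw [hF]
  rw [sahiE_comp_perm]
  rfl

/-- `E^{σ}` of an `e`-free event vanishes: `σ(1_X) = −(1−t)(μ_p(X¹) − μ_p(X⁰)) = 0` when `X¹ = X⁰ = X`. [this work] -/
theorem ex_ind_signedWeight_eq_zero_of_free (p : ι → unitInterval) (e : ι) {X : Set (Set ι)} (hX : ∀ b : Bool, secAt e b X = X) :
    ex (bernoulliWeight p - bernoulliWeight (update p e 1)) (ind X) = 0 := by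
  rw [ex_ind_signedWeight, hX true, hX false, sub_self, mul_zero, neg_zero]

omit [Fintype ι] in
/-- Intersections of `e`-free events are `e`-free. [folklore] -/
theorem secAt_inter_of_free (e : ι) {X Y : Set (Set ι)} (hX : ∀ b : Bool, secAt e b X = X) (hY : ∀ b : Bool, secAt e b Y = Y) (b : Bool) :
    secAt e b (X ∩ Y) = X ∩ Y := by
  rw [secAt_inter, hX, hY]

omit [Fintype ι] in
/-- If `X ∩ S` and `Y ∩ S` are `e`-free then so is `X ∩ Y ∩ S`. [folklore] -/
theorem secAt_inter_inter_of_free (e : ι) {X Y S : Set (Set ι)} (hX : ∀ b : Bool, secAt e b (X ∩ S) = X ∩ S)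
    (hY : ∀ b : Bool, secAt e b (Y ∩ S) = Y ∩ S) (b : Bool) : secAt e b (X ∩ (Y ∩ S)) = X ∩ (Y ∩ S) := by
  have h : X ∩ (Y ∩ S) = (X ∩ S) ∩ (Y ∩ S) := by
    ext ω; simp only [Set.mem_inter_iff]; tauto
  rw [h, secAt_inter, hX, hY]

/-- **A shield kills the signed-weight functional**, every order, every `p`: if some member `U_{k₀}` is `e`-free and all `U_i ∩ U_{k₀}` are `e`-free,
then `E_k(μ_p − μ_{p[e↦1]}; 1_U) = 0`. [this work] -/
theorem sahiE_signedWeight_eq_zero_of_shield (p : ι → unitInterval) (e : ι) :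
    ∀ {k : ℕ} (U : Fin k → Set (Set ι)) (k₀ : Fin k), (∀ b : Bool, secAt e b (U k₀) = U k₀) →
      (∀ (i : Fin k) (b : Bool), secAt e b (U i ∩ U k₀) = U i ∩ U k₀) →
        sahiE (bernoulliWeight p - bernoulliWeight (update p e 1)) k (fun j => ind (U j)) = 0
  | 0, U, k₀, _, _ => Fin.elim0 k₀
  | k + 1, U, k₀, h0, hi => by
    -- move the shield to the head
    rw [sahiE_ind_eq_cons_succAbove _ U k₀]
    cases k with
    | zero =>
      rw [sahiE_one_apply, Matrix.cons_val_zero]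
      exact ex_ind_signedWeight_eq_zero_of_free p e h0
    | succ k =>
      rw [sahiE_cons, ex_ind_signedWeight_eq_zero_of_free p e h0, mul_zero, sub_zero]
      refine Finset.sum_eq_zero fun l _ => ?_
      rw [update_ind_mul_ind]
      -- the updated family `V = (U ∘ succAbove k₀) with slot l ↦ U_{k₀.succAbove l} ∩ U_{k₀}` is shielded by its slot `l`
      refine sahiE_signedWeight_eq_zero_of_shield p e (update (fun j => U (k₀.succAbove j)) l (U (k₀.succAbove l) ∩ U k₀)) l ?_ ?_
      · intro b; rw [update_self]; exact hi _ b
      · intro i b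
        rw [update_self]
        by_cases hil : i = l
        · subst hil; rw [update_self, Set.inter_self]; exact hi _ b
        · rw [update_of_ne hil]; exact secAt_inter_inter_of_free e (hi _) (hi _) b

/-! ### The expansion and its consequences -/

section Shield

variable (p : ι → unitInterval) (e : ι) {k : ℕ} (U : Fin k → Set (Set ι)) (k₀ : Fin k)

/-- **Section expansion of a shielded family**: `E_k(μ_p;1_U) = E_k(μ_p;1_{U¹}) − Σ_A E_{|A|}(σ;1_{U_A})·E_{k−|A|}(μ_p;1_{(U¹)_{Aᶜ}})` (the `A = univ` term is the
vanishing `E(σ;1_U)·E_0`, the coefficients `−E(σ;1_{U_A})` are `≥ 0` for increasing `U`). [this work] -/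
theorem sahiE_ind_shield_eq (h0 : ∀ b : Bool, secAt e b (U k₀) = U k₀) (hi : ∀ (i : Fin k) (b : Bool), secAt e b (U i ∩ U k₀) = U i ∩ U k₀) :
    sahiE (bernoulliWeight p) k (fun j => ind (U j)) =
      sahiE (bernoulliWeight p) k (fun j => ind (secAt e true (U j))) -
        ∑ A : Finset (Fin k),
          sahiE (bernoulliWeight p - bernoulliWeight (update p e 1)) A.card (fun j => ind (U (A.orderEmbOfFin rfl j))) *
            sahiE (bernoulliWeight p) Aᶜ.card (fun j => ind (secAt e true (U (Aᶜ.orderEmbOfFin rfl j)))) := by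
  rw [sahiE_ind_section_expansion p e U, sahiE_signedWeight_eq_zero_of_shield p e U k₀ h0 hi, add_zero]

/-- **`C_k` for shielded families from the sub-families of the `1`-section**: if `U` is increasing and shielded and every sub-family functional
`E(μ_p; 1_{(U¹)_B}) ≥ 0`, then `E_k(μ_p;1_U) ≥ E_k(μ_p;1_{U¹}) ≥ 0`. [this work] -/
theorem sahiE_ind_shield_nonneg (h0 : ∀ b : Bool, secAt e b (U k₀) = U k₀) (hi : ∀ (i : Fin k) (b : Bool), secAt e b (U i ∩ U k₀) = U i ∩ U k₀)
    (hU : ∀ j, IsUpperSet (U j))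
    (H : ∀ B : Finset (Fin k), 0 ≤ sahiE (bernoulliWeight p) B.card (fun j => ind (secAt e true (U (B.orderEmbOfFin rfl j))))) :
    sahiE (bernoulliWeight p) k (fun j => ind (secAt e true (U j))) ≤ sahiE (bernoulliWeight p) k (fun j => ind (U j)) ∧
      0 ≤ sahiE (bernoulliWeight p) k (fun j => ind (U j)) := by
  have hsec : 0 ≤ sahiE (bernoulliWeight p) k (fun j => ind (secAt e true (U j))) := by
    have h := H univ
    rwa [sahiE_sub_univ (bernoulliWeight p) (fun j => ind (secAt e true (U j)))] at h
  have hsum : ∑ A : Finset (Fin k),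
      sahiE (bernoulliWeight p - bernoulliWeight (update p e 1)) A.card (fun j => ind (U (A.orderEmbOfFin rfl j))) *
        sahiE (bernoulliWeight p) Aᶜ.card (fun j => ind (secAt e true (U (Aᶜ.orderEmbOfFin rfl j)))) ≤ 0 :=
    Finset.sum_nonpos fun A _ => mul_nonpos_of_nonpos_of_nonneg
      (sahiE_signedWeight_nonpos p e (fun j => U (A.orderEmbOfFin rfl j)) fun j => hU _) (H Aᶜ)
  rw [sahiE_ind_shield_eq p e U k₀ h0 hi]
  constructor <;> linarith

end Shield

/-- **The settled class is closed under shielding, every order.**  `p` interior, `U` increasing and shielded at `e`; if every sub-family of the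
`1`-section family `U¹` is settled on the open cube, then `U` is settled at `p`: `E_k(μ_p;1_U) ≥ 0` and `E_k(μ_p;1_U) = 0 ↔ U ∈ Z_k`. [this work] -/
theorem sahiE_ind_shield_settled {p : ι → unitInterval} (hp : ∀ i, (p i : ℝ) ∈ Set.Ioo (0 : ℝ) 1) (e : ι) {k : ℕ} {U : Fin k → Set (Set ι)}
    (k₀ : Fin k) (h0 : ∀ b : Bool, secAt e b (U k₀) = U k₀) (hi : ∀ (i : Fin k) (b : Bool), secAt e b (U i ∩ U k₀) = U i ∩ U k₀)
    (hU : ∀ j, IsUpperSet (U j))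
    (H : ∀ (B : Finset (Fin k)) (r : ι → unitInterval), (∀ i, (r i : ℝ) ∈ Set.Ioo (0 : ℝ) 1) →
      0 ≤ sahiE (bernoulliWeight r) B.card (fun j => ind (secAt e true (U (B.orderEmbOfFin rfl j)))) ∧
        (sahiE (bernoulliWeight r) B.card (fun j => ind (secAt e true (U (B.orderEmbOfFin rfl j)))) = 0 ↔
          SuppZeroFlag B.card (fun j => secAt e true (U (B.orderEmbOfFin rfl j))))) :
    0 ≤ sahiE (bernoulliWeight p) k (fun j => ind (U j)) ∧
      (sahiE (bernoulliWeight p) k (fun j => ind (U j)) = 0 ↔ SuppZeroFlag k U) := by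
  refine ⟨(sahiE_ind_shield_nonneg p e U k₀ h0 hi hU fun B => (H B p hp).1).2, fun hz => ?_, fun hZ => masterFamilyEqIff_mpr _ ι p _ hZ⟩
  refine Pointwise.suppZeroFlag_of_eq_zero_on_paramBox U hU (a := fun _ => 0) (b := fun _ => 1) (fun _ => zero_lt_one) (fun _ => le_rfl)
    (fun _ => le_rfl) fun q _ => ?_
  -- decompose the zero at `p`
  rw [sahiE_ind_shield_eq p e U k₀ h0 hi] at hz
  have hsec : 0 ≤ sahiE (bernoulliWeight p) k (fun j => ind (secAt e true (U j))) := by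
    have h := (H univ p hp).1
    rwa [sahiE_sub_univ (bernoulliWeight p) (fun j => ind (secAt e true (U j)))] at h
  have hnn : ∀ A ∈ (univ : Finset (Finset (Fin k))),
      sahiE (bernoulliWeight p - bernoulliWeight (update p e 1)) A.card (fun j => ind (U (A.orderEmbOfFin rfl j))) *
        sahiE (bernoulliWeight p) Aᶜ.card (fun j => ind (secAt e true (U (Aᶜ.orderEmbOfFin rfl j)))) ≤ 0 :=
    fun A _ => mul_nonpos_of_nonpos_of_nonneg
      (sahiE_signedWeight_nonpos p e (fun j => U (A.orderEmbOfFin rfl j)) fun j => hU _) (H Aᶜ p hp).1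
  have hle := Finset.sum_nonpos hnn
  have hsum0 : ∑ A : Finset (Fin k),
      sahiE (bernoulliWeight p - bernoulliWeight (update p e 1)) A.card (fun j => ind (U (A.orderEmbOfFin rfl j))) *
        sahiE (bernoulliWeight p) Aᶜ.card (fun j => ind (secAt e true (U (Aᶜ.orderEmbOfFin rfl j)))) = 0 := by linarith
  have hsec0 : sahiE (bernoulliWeight p) k (fun j => ind (secAt e true (U j))) = 0 := by linarith
  have hterm := (Finset.sum_eq_zero_iff_of_nonpos hnn).1 hsum0
  -- transfer to `q`
  rw [sahiE_ind_shield_eq q e U k₀ h0 hi]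
  have hsec0q : sahiE (bernoulliWeight q) k (fun j => ind (secAt e true (U j))) = 0 := by
    have hZ := ((H univ p hp).2).1 (by rwa [sahiE_sub_univ (bernoulliWeight p) (fun j => ind (secAt e true (U j)))])
    have h0' := masterFamilyEqIff_mpr _ ι q _ hZ
    rwa [sahiE_sub_univ (bernoulliWeight q) (fun j => ind (secAt e true (U j)))] at h0'
  rw [hsec0q, Finset.sum_eq_zero fun A hA => ?_, sub_zero]
  rcases mul_eq_zero.mp (hterm A hA) with h1 | h1
  · rw [sahiE_signedWeight_eq_zero_transfer hp q e (fun j => U (A.orderEmbOfFin rfl j)) (fun j => hU _) h1, zero_mul]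
  · rw [masterFamilyEqIff_mpr _ ι q _ (((H Aᶜ p hp).2).1 h1), mul_zero]

/-- **Strict form**: a shielded increasing family outside `Z_k` has `E_k(μ_p;1_U) > 0` at every interior `p`, under the hypotheses of
`sahiE_ind_shield_settled`. [this work] -/
theorem sahiE_ind_shield_pos {p : ι → unitInterval} (hp : ∀ i, (p i : ℝ) ∈ Set.Ioo (0 : ℝ) 1) (e : ι) {k : ℕ} {U : Fin k → Set (Set ι)}
    (k₀ : Fin k) (h0 : ∀ b : Bool, secAt e b (U k₀) = U k₀) (hi : ∀ (i : Fin k) (b : Bool), secAt e b (U i ∩ U k₀) = U i ∩ U k₀)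
    (hU : ∀ j, IsUpperSet (U j))
    (H : ∀ (B : Finset (Fin k)) (r : ι → unitInterval), (∀ i, (r i : ℝ) ∈ Set.Ioo (0 : ℝ) 1) →
      0 ≤ sahiE (bernoulliWeight r) B.card (fun j => ind (secAt e true (U (B.orderEmbOfFin rfl j)))) ∧
        (sahiE (bernoulliWeight r) B.card (fun j => ind (secAt e true (U (B.orderEmbOfFin rfl j)))) = 0 ↔
          SuppZeroFlag B.card (fun j => secAt e true (U (B.orderEmbOfFin rfl j)))))
    (hZ : ¬ SuppZeroFlag k U) : 0 < sahiE (bernoulliWeight p) k (fun j => ind (U j)) := by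
  obtain ⟨h0', hiff⟩ := sahiE_ind_shield_settled hp e k₀ h0 hi hU H
  exact lt_of_le_of_ne h0' fun h => hZ (hiff.1 h.symm)

end Pinning

end Summit.CriticalPhenomena.PercolationContinuityZ3.Theorems
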